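import Mathlib
import HarnessLib
import Summits.AtomisticToContinuum.BoseEinsteinCondensation.Theses.BECFeynmanVortexArea
import Summits.AtomisticToContinuum.BoseEinsteinCondensation.Theorems.BECConjugateDominationInfraredMinimumUncertaintyGroundStateRepresentation

/-!
# Route `BECFeynmanVortexArea` — support item `GroundStateRepresentation`
# (stmt-AtomisticToContinuum-12607), PROVED

The ground-state representation (ground-state transform, "Jacobi's trick") of a positive periodic
minimiser, in the `ℝ≥0∞` form filed by the route: for a bounded repulsive finite-range profile `v`,
a periodic `C¹` trial state `Φ` of `N` bosons on the torus of side `L` with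
`periodicEnergy v Φ = E₀ := periodicGroundStateEnergy v N L < ∞` and `Φ` real positive, and every
`C¹`, `Lℤ³`-periodic, Bose-symmetric map `F : (ℝ³)^N → ℂ`,

  `∫_cell (|∇(FΦ)|² + V^per |FΦ|²) = E₀ · ∫_cell |F|² Φ² + ∫_cell |∇F|² Φ²`.

Proof. All the analysis is already in the tree (route `BECConjugateDomination`, crux
`InfraredMinimumUncertainty`): the weak Euler–Lagrange identity of a finite-energy minimiser under a
bounded interaction (`ImuWeakEulerLagrange.firstVariation_eq`, first variation of the Rayleigh
quotient along `Φ + tη`) tested with `η = conj(F) (F Φ) = |F|² Φ`, inserted into the pointwise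
expansion `|∂(FΦ)|² = |∂F|² Φ² + Re(conj(∂η) ∂Φ)` (`ImuGroundStateRepresentation.form_modulated_sub_eq`),
gives the identity for real Bochner integrals on the cell, `A - E₀.toReal · B = C`. Here we (i) bound
the periodised interaction of a bounded finite-range profile uniformly
(`ImuWeakEulerLagrange.periodizedPotential_le_of_bound`, `periodicInteraction_le_of_bound`; for
`L ≤ 0` the trial class is empty unless `N = 0`, when the interaction is an empty sum), (ii) turn
`0 < Re Φ`, `Im Φ = 0` into `Φ = |Φ|`, and (iii) convert the three `ℝ≥0∞` cell integrals of the
continuous non-negative integrands into `ofReal` of Bochner integrals, so that the real identity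
becomes the filed one (`ofReal (E₀r B + C) = E₀ · ofReal B + ofReal C`, no subtraction).

References: [ReedSimonIV1978] §XIII.12 (ground-state transform); [CorneanDerezinskiZin2009] §2
(sectorial form); [Fournais2020] (1.1)–(1.2) (the periodic problem).
-/

noncomputable section

open MeasureTheory Filter Set
open scoped ENNReal NNReal Topology ComplexConjugate BigOperators

namespace Summit.AtomisticToContinuum.BoseEinsteinCondensation.Theorems

open Literature.MathematicalPhysics.QuantumManyBody.BoseGas

namespace FvaGroundStateRepresentation

variable {N : ℕ} {L : ℝ}

/-- A bounded finite-range profile has a uniformly bounded periodic interaction on every trial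
class that is inhabited: for `L > 0` by counting lattice images
(`ImuWeakEulerLagrange.periodizedPotential_le_of_bound`), and for `L ≤ 0` the class
`PeriodicTrialState N L` is empty unless `N = 0` (the cell `[0,L)^{3N}` is empty), in which case
the interaction is an empty sum. [folklore] -/
theorem exists_periodicInteraction_le_of_bounded {v : ℝ → ℝ≥0∞} (hv : IsRepulsiveFiniteRange v)
    (hbdd : ∃ M : ℝ≥0, ∀ r, v r ≤ M) (Φ : PeriodicTrialState N L) :
    ∃ Cw : ℝ≥0∞, Cw ≠ ⊤ ∧ ∀ X : Config N, periodicInteraction v L X ≤ Cw := by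
  rcases lt_or_ge 0 L with hL | hL
  · obtain ⟨M, hM⟩ := hbdd
    obtain ⟨R₀, hR₀⟩ := hv.2
    have hvC : ∀ x : Space, v ‖x‖ ≤ ENNReal.ofReal (M : ℝ) := fun x => by
      rw [ENNReal.ofReal_coe_nnreal]; exact hM _
    have hvR : ∀ r, max R₀ 0 < r → v r = 0 := fun r hr =>
      hR₀ r ((le_max_left _ _).trans_lt hr)
    exact ⟨_, ENNReal.mul_ne_top (ENNReal.natCast_ne_top _) ENNReal.ofReal_ne_top,
      fun X => periodicInteraction_le_of_bound
        (ImuWeakEulerLagrange.periodizedPotential_le_of_bound M.coe_nonneg (le_max_right _ _) hL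
          hvC hvR) X⟩
  · refine ⟨0, ENNReal.zero_ne_top, fun X => ?_⟩
    rcases Nat.eq_zero_or_pos N with hN | hN
    · subst hN
      simp [periodicInteraction]
    · exfalso
      have hcell : cellN N L = ∅ := by
        ext X
        simp only [cellN, cell, Set.mem_setOf_eq, Set.mem_Ico, Set.mem_empty_iff_false, iff_false,
          not_forall]
        exact ⟨⟨0, hN⟩, 0, fun h => (h.1.trans_lt h.2).not_ge hL⟩
      have h1 := Φ.norm_eq
      rw [hcell, setLIntegral_empty] at h1
      exact zero_ne_one h1

/-- A complex number with positive real part and zero imaginary part equals (the cast of) its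
norm. [folklore] -/
theorem eq_coe_norm_of_re_pos_im_zero {z : ℂ} (hre : 0 < z.re) (him : z.im = 0) :
    z = (‖z‖ : ℂ) := by
  have hz : z = (z.re : ℂ) := Complex.ext (by simp) (by simp [him])
  rw [hz, Complex.norm_real, Real.norm_of_nonneg hre.le]

/-- `∫⁻_cell ‖F‖₊² ‖Φ‖₊² = ofReal ∫_cell ‖F‖² ‖Φ‖²` for continuous `F, Φ` (bounded cell). [folklore] -/
theorem lintegral_nnnorm_sq_mul_eq_ofReal {F Φ : Config N → ℂ} (hF : Continuous F)
    (hΦ : Continuous Φ) (L : ℝ) :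
    ∫⁻ X in cellN N L, (‖F X‖₊ : ℝ≥0∞) ^ 2 * (‖Φ X‖₊ : ℝ≥0∞) ^ 2 =
      ENNReal.ofReal (∫ X in cellN N L, ‖F X‖ ^ 2 * ‖Φ X‖ ^ 2) := by
  rw [ofReal_integral_eq_lintegral_ofReal (integrableOn_cellN (by fun_prop) L)
    (ae_of_all _ fun X => mul_nonneg (sq_nonneg _) (sq_nonneg _))]
  refine lintegral_congr fun X => ?_
  rw [coe_nnnorm_sq_eq_ofReal, coe_nnnorm_sq_eq_ofReal, ← ENNReal.ofReal_mul (sq_nonneg _)]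

/-- `∫⁻_cell |∇F|² ‖Φ‖₊² = ofReal ∫_cell |∇F|²_ℝ ‖Φ‖²` for `F ∈ C¹` and continuous `Φ`. [folklore] -/
theorem lintegral_kineticDensity_mul_eq_ofReal {F Φ : Config N → ℂ} (hF : ContDiff ℝ 1 F)
    (hΦ : Continuous Φ) (L : ℝ) :
    ∫⁻ X in cellN N L, kineticDensity F X * (‖Φ X‖₊ : ℝ≥0∞) ^ 2 =
      ENNReal.ofReal (∫ X in cellN N L, kineticDensityReal F X * ‖Φ X‖ ^ 2) := by
  have hc := continuous_kineticDensityReal hF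
  rw [ofReal_integral_eq_lintegral_ofReal (integrableOn_cellN (by fun_prop) L)
    (ae_of_all _ fun X => mul_nonneg (kineticDensityReal_nonneg F X) (sq_nonneg _))]
  refine lintegral_congr fun X => ?_
  rw [kineticDensity_eq_ofReal, coe_nnnorm_sq_eq_ofReal,
    ← ENNReal.ofReal_mul (kineticDensityReal_nonneg F X)]

end FvaGroundStateRepresentation

open FvaGroundStateRepresentation in
/-- **`GroundStateRepresentation` (route `BECFeynmanVortexArea`, item stmt-AtomisticToContinuum-12607),
proved.** For a bounded repulsive finite-range `v`, a periodic `C¹` trial state `Φ` attaining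
`E₀^per(N,L) < ∞` with `Φ` real positive, and a `C¹` `Lℤ³`-periodic permutation-symmetric `F`:
`∫_cell (|∇(FΦ)|² + V^per|FΦ|²) = E₀^per(N,L) · ∫_cell |F|²Φ² + ∫_cell |∇F|²Φ²` in `ℝ≥0∞`.
Proof: weak Euler–Lagrange identity of the minimiser tested with `η = |F|²Φ`
(`ImuWeakEulerLagrange.firstVariation_eq`) and the pointwise expansion of `|∇(FΦ)|²`
(`ImuGroundStateRepresentation.form_modulated_sub_eq`), transported from real Bochner integrals to
`ℝ≥0∞`. [cite: ReedSimonIV1978, §XIII.12] -/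
theorem becFeynmanVortexArea_groundStateRepresentation_proof :
    Theses.BECFeynmanVortexArea.GroundStateRepresentation := by
  intro v hv hbdd N L Φ hmin hfin hpos F hF hFper hFsymm
  obtain ⟨Cw, hCw, hW⟩ := exists_periodicInteraction_le_of_bounded hv hbdd Φ
  have hreal : ∀ X, Φ.ψ X = (‖Φ.ψ X‖ : ℂ) := fun X =>
    eq_coe_norm_of_re_pos_im_zero (hpos X).1 (hpos X).2
  have hfin' : periodicEnergy v Φ ≠ ⊤ := hmin ▸ hfin
  -- the test function `η = conj(F) (F Φ) = |F|² Φ`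
  have hη : ContDiff ℝ 1 (fun Y : Config N => conj (F Y) * (F Y * Φ.ψ Y)) :=
    (Complex.conjCLE.contDiff.comp hF).mul (hF.mul Φ.contDiff)
  have hηper : ∀ (X : Config N) (i : Fin N) (k : Fin 3),
      (fun Y : Config N => conj (F Y) * (F Y * Φ.ψ Y)) (X + Pi.single i (EuclideanSpace.single k L)) =
        (fun Y : Config N => conj (F Y) * (F Y * Φ.ψ Y)) X := fun X i k => by
    simp only [hFper, Φ.periodic]
  have hηsymm : ∀ (σ : Equiv.Perm (Fin N)) (X : Config N),
      (fun Y : Config N => conj (F Y) * (F Y * Φ.ψ Y)) (X ∘ σ) =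
        (fun Y : Config N => conj (F Y) * (F Y * Φ.ψ Y)) X := fun σ X => by
    simp only [hFsymm, Φ.symm]
  have hEL := ImuWeakEulerLagrange.firstVariation_eq hv.1 hCw hW Φ hmin hfin' hη hηper hηsymm
  have hid := ImuGroundStateRepresentation.form_modulated_sub_eq hv.1 hCw hW Φ hreal hF _ hEL
  -- the three `ℝ≥0∞` integrals in real form
  have hA : ∫⁻ X in cellN N L, (kineticDensity (fun Y => F Y * Φ.ψ Y) X +
      periodicInteraction v L X * (‖F X * Φ.ψ X‖₊ : ℝ≥0∞) ^ 2) =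
      ENNReal.ofReal (∫ X in cellN N L, ((∑ i : Fin N, ∑ k : Fin 3,
        ‖fderiv ℝ (fun Y : Config N => F Y * Φ.ψ Y) X
          (Pi.single i (EuclideanSpace.single k (1 : ℝ)))‖ ^ 2) +
        (periodicInteraction v L X).toReal * ‖F X * Φ.ψ X‖ ^ 2)) :=
    ImuWeakEulerLagrange.periodicForm_eq_ofReal hv.1 hCw hW (hF.mul Φ.contDiff)
  have hB : ∫⁻ X in cellN N L, (‖F X‖₊ : ℝ≥0∞) ^ 2 * (‖Φ.ψ X‖₊ : ℝ≥0∞) ^ 2 =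
      ENNReal.ofReal (∫ X in cellN N L, ‖F X * Φ.ψ X‖ ^ 2) := by
    rw [lintegral_nnnorm_sq_mul_eq_ofReal hF.continuous Φ.contDiff.continuous]
    congr 1
    refine integral_congr_ae (ae_of_all _ fun X => ?_)
    simp only [norm_mul, mul_pow]
  have hC : ∫⁻ X in cellN N L, kineticDensity F X * (‖Φ.ψ X‖₊ : ℝ≥0∞) ^ 2 =
      ENNReal.ofReal (∫ X in cellN N L, (∑ i : Fin N, ∑ k : Fin 3,
        ‖fderiv ℝ F X (Pi.single i (EuclideanSpace.single k (1 : ℝ)))‖ ^ 2) * ‖Φ.ψ X‖ ^ 2) :=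
    lintegral_kineticDensity_mul_eq_ofReal hF Φ.contDiff.continuous L
  -- non-negativity of the real integrals and of `E₀.toReal`
  have hBnn : 0 ≤ ∫ X in cellN N L, ‖F X * Φ.ψ X‖ ^ 2 := integral_nonneg fun X => sq_nonneg _
  have hCnn : 0 ≤ ∫ X in cellN N L, (∑ i : Fin N, ∑ k : Fin 3,
      ‖fderiv ℝ F X (Pi.single i (EuclideanSpace.single k (1 : ℝ)))‖ ^ 2) * ‖Φ.ψ X‖ ^ 2 :=
    integral_nonneg fun X => mul_nonneg
      (Finset.sum_nonneg fun _ _ => Finset.sum_nonneg fun _ _ => sq_nonneg _) (sq_nonneg _)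
  rw [hA, hB, hC, ← ENNReal.ofReal_toReal hfin, ← ENNReal.ofReal_mul ENNReal.toReal_nonneg,
    ← ENNReal.ofReal_add (mul_nonneg ENNReal.toReal_nonneg hBnn) hCnn]
  congr 1
  linarith [hid]

end Summit.AtomisticToContinuum.BoseEinsteinCondensation.Theorems

end
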